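import Mathlib
import Summits.ResolutionOfSingularities.ResolutionOfSingularities.Theorems.PAlterationPicoverLocalModelWoundTwistIntegralClosure

/-!
# Crux `PicoverLocalModel` (stmt-ResolutionOfSingularities-0557), line `SketchIdeator3`
# (giraud-cossart-normal-form) — endgame, local charts: recognising the local rings of the
# normalised cover from a model of the integral closure

Helper of the stub `stub_localCharts`. The local rings of the normalisation `Y^ν` of the
pulled-back `p`-cyclic cover `Y = X_a ×_{Spec R} W` at the points over `w ∈ W` are reached in
two steps from `O = 𝒪_{W,w}`: the model `A' = O[t]/(f)`, `f = t^p - a`, and "the" integral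
closure of `A'` in its fraction field. What the scheme `Y^ν` hands us is not literally
`integralClosure A' (Frac A')` but an abstract `O`-algebra `N` which is an integrally closed
domain, integral over `O`, containing a root `t` of `f`, and BIRATIONAL to `A'` (every element
is `q(t)/d` with `d ∈ O ∖ 0`). This file proves that such an `N` is isomorphic, as an
`O`-algebra, to any model `C` of the integral closure presented as the image of an injective
`O`-algebra map `φ : C → Frac A'` with `φ(C) = integralClosure A' (Frac A')` — the form in which
the two local models of the line were landed (`range_woundTwist_eq_integralClosure`,
`integralClosure_model_eq_range_toric`):

* `liftAlgHom_injective_of_isIntegral` — `A' → N`, `t ↦ t`, is injective;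
* `exists_algEquiv_of_integralClosure_eq_range` — `N ≃ₐ[O] C`.
-/

noncomputable section

-- single-problem summit: the doubled namespace component `ResolutionOfSingularities` is the tree layout
set_option linter.dupNamespace false

open Polynomial

namespace Summit.ResolutionOfSingularities.ResolutionOfSingularities.Theorems.PicoverLocalModel.LocalCharts

/-- For a monic `f ∈ O[X]` with `O[X]/(f)` a domain, and an `O`-algebra `N` which is a domain
with `O → N` injective, the map `O[X]/(f) → N` to a root of `f` is injective: its kernel is a
prime lying over `(0)` in the integral extension `O ⊆ O[X]/(f)`. [folklore] -/
theorem liftAlgHom_injective_of_isIntegral {O N : Type*} [CommRing O] [CommRing N]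
    [IsDomain N] [Algebra O N] (f : O[X]) (hf : f.Monic) [IsDomain (AdjoinRoot f)] (t : N)
    (ht : f.eval₂ (Algebra.ofId O N) t = 0) (hinj : Function.Injective (algebraMap O N)) :
    Function.Injective (AdjoinRoot.liftAlgHom f (Algebra.ofId O N) t ht) := by
  haveI : Module.Finite O (AdjoinRoot f) := hf.finite_adjoinRoot
  haveI : Algebra.IsIntegral O (AdjoinRoot f) := inferInstance
  haveI : Nontrivial O := nontrivial_of_ne (0 : O) 1 fun h => by
    have h' := congrArg (algebraMap O N) h
    rw [map_zero, map_one] at h'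
    exact zero_ne_one h'
  rw [injective_iff_map_eq_zero]
  intro z hz
  have hker : RingHom.ker (AdjoinRoot.liftAlgHom f (Algebra.ofId O N) t ht).toRingHom = ⊥ := by
    refine Ideal.eq_bot_of_comap_eq_bot (R := O) ?_
    rw [eq_bot_iff]
    intro b hb
    rw [Ideal.mem_comap, RingHom.mem_ker, AlgHom.toRingHom_eq_coe, AlgHom.coe_toRingHom,
      AdjoinRoot.algebraMap_eq, AdjoinRoot.liftAlgHom_of] at hb
    change algebraMap O N b = 0 at hb
    rw [Ideal.mem_bot]
    exact hinj (by rw [hb, map_zero])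
  have : z ∈ RingHom.ker (AdjoinRoot.liftAlgHom f (Algebra.ofId O N) t ht).toRingHom := hz
  rw [hker, Ideal.mem_bot] at this
  exact this

/-- **Recognising the local ring of the normalised cover.** Let `f ∈ O[X]` be monic with
`A' = O[X]/(f)` a domain, and `N` an `O`-algebra which is an integrally closed domain,
integral over `O`, with `O → N` injective, containing a root `t` of `f` such that every
element of `N` is `q(t)/d` with `d ∈ O ∖ 0` (birationality). Then for every `O`-algebra `C`
and injective `O`-algebra map `φ : C → Frac A'` whose image is the integral closure of `A'`,
`N ≅ C` as `O`-algebras: `Frac N` is a fraction field of `A'`, so `N` embeds into `Frac A'`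
over `A'` with image the integral closure (`integralClosure_eq_range_of_isIntegrallyClosed`),
i.e. with the same image as `φ`. [folklore] -/
theorem exists_algEquiv_of_integralClosure_eq_range : ∀ {O N C : Type*} [CommRing O] [CommRing N] [IsDomain N] [IsIntegrallyClosed N] [Algebra O N] [Algebra.IsIntegral O N] [CommRing C] [Algebra O C] (f : Polynomial O), f.Monic → ∀ [IsDomain (AdjoinRoot f)] (t : N), Polynomial.aeval t f = 0 → Function.Injective (algebraMap O N) → (∀ z : N, ∃ d : O, d ≠ 0 ∧ ∃ q : Polynomial O, algebraMap O N d * z = Polynomial.aeval t q) → ∀ (φ : C →ₐ[O] FractionRing (AdjoinRoot f)), Function.Injective φ → (integralClosure (AdjoinRoot f) (FractionRing (AdjoinRoot f))).toSubring = φ.toRingHom.range → Nonempty (N ≃ₐ[O] C) := by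
  intro O N C _ _ _ _ _ _ _ _ f hf _ t ht' hinj hbir' φ hφ hrange
  have ht : f.eval₂ (Algebra.ofId O N) t = 0 := by rw [← ht', Polynomial.aeval_def]; rfl
  have hbir : ∀ z : N, ∃ d : O, d ≠ 0 ∧ ∃ q : O[X],
      algebraMap O N d * z = q.eval₂ (algebraMap O N) t := fun z => by
    obtain ⟨d, hd, q, h⟩ := hbir' z
    exact ⟨d, hd, q, by rw [h, Polynomial.aeval_def]⟩
  classical
  haveI : Module.Finite O (AdjoinRoot f) := hf.finite_adjoinRoot
  haveI : Algebra.IsIntegral O (AdjoinRoot f) := inferInstance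
  -- `A' → N`, `t ↦ t`, injective
  set i : AdjoinRoot f →ₐ[O] N := AdjoinRoot.liftAlgHom f (Algebra.ofId O N) t ht with hidef
  have hi : Function.Injective i := liftAlgHom_injective_of_isIntegral f hf t ht hinj
  have hq : ∀ q : O[X], q.eval₂ (algebraMap O N) t = i (AdjoinRoot.mk f q) := fun q => by
    rw [hidef, AdjoinRoot.liftAlgHom_mk]; rfl
  have hd : ∀ d : O, algebraMap O N d = i (AdjoinRoot.of f d) := fun d => by
    rw [hidef, AdjoinRoot.liftAlgHom_of]; rfl
  -- `L = Frac N` is a fraction field of `A'`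
  letI algA'N : Algebra (AdjoinRoot f) N := i.toRingHom.toAlgebra
  haveI : IsScalarTower O (AdjoinRoot f) N :=
    IsScalarTower.of_algebraMap_eq fun b => (i.commutes b).symm
  haveI : IsScalarTower O (AdjoinRoot f) (FractionRing N) :=
    IsScalarTower.of_algebraMap_eq fun b => by
      rw [IsScalarTower.algebraMap_apply O N (FractionRing N),
        IsScalarTower.algebraMap_apply (AdjoinRoot f) N (FractionRing N),
        ← IsScalarTower.algebraMap_apply O (AdjoinRoot f) N]
  have hinjA'L : Function.Injective (algebraMap (AdjoinRoot f) (FractionRing N)) :=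
    (IsFractionRing.injective N (FractionRing N)).comp hi
  haveI : FaithfulSMul (AdjoinRoot f) (FractionRing N) :=
    (faithfulSMul_iff_algebraMap_injective _ _).mpr hinjA'L
  haveI : IsFractionRing (AdjoinRoot f) (FractionRing N) := by
    refine IsFractionRing.of_field (AdjoinRoot f) (FractionRing N) fun z => ?_
    obtain ⟨n₁, n₂, -, rfl⟩ := IsFractionRing.div_surjective (A := N) z
    obtain ⟨d₁, hd₁, q₁, h₁⟩ := hbir n₁
    obtain ⟨d₂, hd₂, q₂, h₂⟩ := hbir n₂
    refine ⟨AdjoinRoot.mk f q₁ * AdjoinRoot.of f d₂, AdjoinRoot.mk f q₂ * AdjoinRoot.of f d₁, ?_⟩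
    set D : N := algebraMap O N d₁ * algebraMap O N d₂ with hD
    have hc : algebraMap N (FractionRing N) D ≠ 0 :=
      (map_ne_zero_iff _ (IsFractionRing.injective N (FractionRing N))).mpr
        (mul_ne_zero ((map_ne_zero_iff _ hinj).mpr hd₁) ((map_ne_zero_iff _ hinj).mpr hd₂))
    have hnum : D * n₁ = i (AdjoinRoot.mk f q₁ * AdjoinRoot.of f d₂) := by
      rw [map_mul, ← hq, ← hd, ← h₁, hD]; ring
    have hden : D * n₂ = i (AdjoinRoot.mk f q₂ * AdjoinRoot.of f d₁) := by
      rw [map_mul, ← hq, ← hd, ← h₂, hD]; ring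
    rw [← mul_div_mul_left _ _ hc, ← map_mul, ← map_mul, hnum, hden,
      IsScalarTower.algebraMap_apply (AdjoinRoot f) N (FractionRing N),
      IsScalarTower.algebraMap_apply (AdjoinRoot f) N (FractionRing N)]
    rfl
  -- `N → Frac N ≅ Frac A'` over `O`
  let e₁ : FractionRing N ≃ₐ[AdjoinRoot f] FractionRing (AdjoinRoot f) :=
    (FractionRing.algEquiv (AdjoinRoot f) (FractionRing N)).symm
  let ι : N →ₐ[O] FractionRing (AdjoinRoot f) :=
    (e₁.restrictScalars O).toAlgHom.comp (IsScalarTower.toAlgHom O N (FractionRing N))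
  have hι : Function.Injective ι :=
    e₁.injective.comp (IsFractionRing.injective N (FractionRing N))
  have hιi : ∀ a' : AdjoinRoot f, ι (i a') = algebraMap _ (FractionRing (AdjoinRoot f)) a' := by
    intro a'
    change e₁ (algebraMap N (FractionRing N) (algebraMap (AdjoinRoot f) N a')) = _
    rw [← IsScalarTower.algebraMap_apply (AdjoinRoot f) N (FractionRing N), AlgEquiv.commutes]
  have hAK : (algebraMap (AdjoinRoot f) (FractionRing (AdjoinRoot f))).range ≤
      ι.toRingHom.range := by
    rintro _ ⟨a', rfl⟩
    exact ⟨i a', hιi a'⟩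
  have hN := WoundTwistIntegralClosure.integralClosure_eq_range_of_isIntegrallyClosed ι hι hAK
  -- same image as `φ`
  have heq : ι.range = φ.range := by
    ext z
    have h1 : z ∈ ι.toRingHom.range ↔ z ∈ φ.toRingHom.range := by rw [← hN, hrange]
    simpa [AlgHom.mem_range, RingHom.mem_range] using h1
  exact ⟨(AlgEquiv.ofInjective ι hι).trans
    ((Subalgebra.equivOfEq _ _ heq).trans (AlgEquiv.ofInjective φ hφ).symm)⟩

end Summit.ResolutionOfSingularities.ResolutionOfSingularities.Theorems.PicoverLocalModel.LocalCharts

end
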